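import Literature.AnabelianGeometry.SemiGraphs.ProSigmaSurfaceFreeProlRank
import Literature.AnabelianGeometry.SemiGraphs.ProSigmaClosedSurfaceSlimCore
import Literature.AnabelianGeometry.AbsoluteAnabelian.ProfiniteElasticCriterionAffineProofs
import HarnessLib

/-!
# [AbsTopI] Prop 2.3 (i) at the model: pro-`Σ` completions of closed surface groups are ELASTIC
# (and slim) — [MT] Thm 1.5 for `Γ_{g,0}`, by the rank route

Topic `AnabelianGeometry/SemiGraphs`, namespace
`Literature.AnabelianGeometry.SemiGraphs.SemiGraphOfAnabelioids.IsProSigmaCompletion` (next to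
`ProSigmaClosedSurfaceSlim*.lean`, the SLIM half).  THEOREMS ONLY (no definition, no named fact).

S. Mochizuki, *Topics in Absolute Anabelian Geometry I* (2012) [AbsTopI], Prop 2.3 (i) p. 19: "`Δ` is
slim and elastic" for `Δ` of GFG-type — in particular for the pro-`Σ` geometric fundamental group of a
hyperbolic curve, which for a PROPER curve of genus `g ≥ 2` is a pro-`Σ` completion of the closed surface
group `Γ_{g,0} ≅ S_g`; the printed proof cites [MT] (Mochizuki–Tamagawa) Thm 1.5.  abc-iut cell, FACT-LIST
row F-0239 `FundamentalExtension.GeomSlimElastic`, L4-lead RULING #4g (2026-08-26): ELASTICITY AT THE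
MODEL by the RANK ROUTE —

* the affine elasticity criterion of abc-iut-L4-t15/t16 (`isElastic_of_affine_rankFormula`, file
  `ProfiniteElasticCriterionAffineProofs.lean`: a profinite group all of whose open subgroups `U` have
  free pro-`p` rank `δ¹_p(U) = c·[Γ : U] + e` with `c ≥ 1` is elastic), fed with
* the linear rank formula `δ¹_ℓ(U) = 2(g − 1)·[P : U] + 2` (`ℓ ∈ Σ`) of `ProSigmaSurfaceFreeProlRank.lean`
  (`freeProlRank_open_eq_of_surfaceGroup`; F_cov `surfaceGroupFiniteIndexSubgroup_holds` + universal
  property of the pro-`Σ` completion).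

Main results: `isElastic_of_isProSigmaCompletion_surfaceGroup` (any `Γ ≅ S_g`),
`isElastic_of_isProSigmaCompletion_closedSurfaceGroup` (the `Γ_{g,0}` form of the slim theorem),
`slim_and_elastic_of_isProSigmaCompletion_closedSurfaceGroup`, and the F-0239-shaped corollary
`FundamentalExtension.geomSlimElastic_of_isProSigmaCompletion_closedSurfaceGroup` for every extension
`1 → Δ → Π → G → 1` whose `Δ` IS (presented as) such a completion.  HONEST SCOPE: MODEL-level — the
abstract predicate `GeomSlimElastic` of an arbitrary typed extension stays a hypothesis elsewhere; the
affine-curve (free pro-`Σ`) case is abc-iut-w5-d206's sibling file; this is NOT the printed proof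
([MT] via configuration spaces) but an independent argument establishing OUR typed predicate.
Nothing here bears on [IUTchIII] Cor. 3.12; typed ≠ proved elsewhere.

## References

* S. Mochizuki, *Topics in Absolute Anabelian Geometry I: Generalities*, J. Math. Sci. Univ. Tokyo 19
  (2012), Prop 2.3 (i) p. 19. [MochizukiAbsTopI2012]
* S. Mochizuki, *The absolute anabelian geometry of hyperbolic curves* (2004), Lemma 1.3.1 p. 15 (slim
  half). [MochizukiAbsAnab2004]
-/

noncomputable section

universe u

namespace Literature.AnabelianGeometry.SemiGraphs.SemiGraphOfAnabelioids.IsProSigmaCompletion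

open Literature.AnabelianGeometry.Anabelioids Literature.AnabelianGeometry.AbsoluteAnabelian Topology
open Literature.AlgebraicGeometry.Frobenioids (IsSlimGroup)
open Literature.GroupTheory.CombinatorialGroupTheory
open Literature.Topology.FourManifolds (SurfaceGroup surfaceGen)

variable {Sigma : Set ℕ} {Γ : Type*} [Group Γ] {P : Type u} [Group P] [TopologicalSpace P]
  [IsTopologicalGroup P] [CompactSpace P] [T2Space P] [TotallyDisconnectedSpace P] {ι : Γ →* P}

/-- **Pro-`Σ` surface groups are elastic.**  Let `ι : Γ → P` be a pro-`Σ` completion (`P` profinite) of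
`Γ ≅ S_g`, `g ≥ 2`, and suppose `Σ` contains a prime `ℓ`.  Then `P` is ELASTIC: every topologically
finitely generated closed normal subgroup of an open subgroup of `P` is trivial or of finite index —
the affine criterion `isElastic_of_affine_rankFormula` with `c = 2(g − 1) ≥ 2`, `e = 2` and the rank
formula `freeProlRank_open_eq_of_surfaceGroup`. [cite: MochizukiAbsTopI2012, Prop 2.3 (i) p.19] -/
theorem isElastic_of_isProSigmaCompletion_surfaceGroup (hι : IsProSigmaCompletion Sigma ι) {g : ℕ}
    (hg : 2 ≤ g) (e : Γ ≃* SurfaceGroup g) {ℓ : ℕ} (hℓ : ℓ.Prime) (hℓS : ℓ ∈ Sigma) : IsElastic P := by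
  haveI : Fact ℓ.Prime := ⟨hℓ⟩
  exact isElastic_of_affine_rankFormula ℓ (2 * (g - 1)) 2 (by omega)
    fun U hU => freeProlRank_open_eq_of_surfaceGroup hι hg e hℓS U hU

/-- **Pro-`Σ` completions of the closed surface group `Γ_{g,0}` (`g ≥ 2`) are elastic** — the shape of
the tree's slim theorem `isSlimGroup_closedSurfaceGroup`, for `Σ` containing a prime.
[cite: MochizukiAbsTopI2012, Prop 2.3 (i) p.19] -/
theorem isElastic_of_isProSigmaCompletion_closedSurfaceGroup (Sigma : Set ℕ)
    (hS : ∃ ℓ ∈ Sigma, ℓ.Prime) (g : ℕ) (hg : 2 ≤ g)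
    (P : Type u) [Group P] [TopologicalSpace P] [IsTopologicalGroup P] [CompactSpace P]
    [T2Space P] [TotallyDisconnectedSpace P] (ι : PuncturedSurfaceGroup g 0 →* P)
    (hι : IsProSigmaCompletion Sigma ι) : IsElastic P := by
  obtain ⟨ℓ, hℓS, hℓ⟩ := hS
  obtain ⟨e⟩ := nonempty_mulEquiv_puncturedSurfaceGroup_zero g
  exact isElastic_of_isProSigmaCompletion_surfaceGroup hι hg e hℓ hℓS

/-- **[AbsTopI] Prop 2.3 (i) at the closed-surface model: "`Δ` is slim and elastic".**  Every pro-`Σ`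
completion of `Γ_{g,0}` (`g ≥ 2`, `Σ` a nonempty set of primes) is slim (tree
`isSlimGroup_closedSurfaceGroup`, [AbsAnab] Lemma 1.3.1) and elastic
(`isElastic_of_isProSigmaCompletion_closedSurfaceGroup`).
[cite: MochizukiAbsTopI2012, Prop 2.3 (i) p.19] [cite: MochizukiAbsAnab2004, Lemma 1.3.1 p.15] -/
theorem slim_and_elastic_of_isProSigmaCompletion_closedSurfaceGroup (Sigma : Set ℕ)
    (hS : Sigma.Nonempty) (hSp : ∀ p ∈ Sigma, p.Prime) (g : ℕ) (hg : 2 ≤ g)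
    (P : Type u) [Group P] [TopologicalSpace P] [IsTopologicalGroup P] [CompactSpace P]
    [T2Space P] [TotallyDisconnectedSpace P] (ι : PuncturedSurfaceGroup g 0 →* P)
    (hι : IsProSigmaCompletion Sigma ι) : IsSlimGroup P ∧ IsElastic P := by
  obtain ⟨ℓ, hℓS⟩ := hS
  exact ⟨isSlimGroup_closedSurfaceGroup Sigma ⟨ℓ, hℓS⟩ hSp g hg P ι hι,
    isElastic_of_isProSigmaCompletion_closedSurfaceGroup Sigma ⟨ℓ, hℓS, hSp ℓ hℓS⟩ g hg P ι hι⟩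

end Literature.AnabelianGeometry.SemiGraphs.SemiGraphOfAnabelioids.IsProSigmaCompletion

namespace Literature.AnabelianGeometry.AbsoluteAnabelian.FundamentalExtension

open Literature.AnabelianGeometry.SemiGraphs.SemiGraphOfAnabelioids
open Literature.GroupTheory.CombinatorialGroupTheory

/-- **F-0239 `GeomSlimElastic` ([AbsTopI] Prop 2.3 (i)) for every extension whose `Δ` is a pro-`Σ`
closed surface group**: if `1 → Δ → Π → G → 1` is an extension of profinite groups and `Δ` is
presented as a pro-`Σ` completion `ι : Γ_{g,0} → Δ` (`g ≥ 2`, `Σ` a nonempty set of primes) — the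
datum carried by a proper hyperbolic curve of genus `g` — then `Δ` is slim and elastic, i.e. the typed
predicate `E.GeomSlimElastic` HOLDS.  (MODEL-level discharge; for an abstract `E` the predicate stays
a hypothesis.) [cite: MochizukiAbsTopI2012, Prop 2.3 (i) p.19] -/
theorem geomSlimElastic_of_isProSigmaCompletion_closedSurfaceGroup (E : FundamentalExtension.{u})
    {Sigma : Set ℕ} (hS : Sigma.Nonempty) (hSp : ∀ p ∈ Sigma, p.Prime) {g : ℕ} (hg : 2 ≤ g)
    (ι : PuncturedSurfaceGroup g 0 →* E.geom) (hι : IsProSigmaCompletion Sigma ι) :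
    E.GeomSlimElastic := by
  haveI : CompactSpace E.geom := isCompact_iff_compactSpace.mp E.isClosed_geom.isCompact
  exact IsProSigmaCompletion.slim_and_elastic_of_isProSigmaCompletion_closedSurfaceGroup Sigma hS hSp
    g hg E.geom ι hι

end Literature.AnabelianGeometry.AbsoluteAnabelian.FundamentalExtension

end
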